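import Mathlib
import Summits.MatrixMultiplication.MatrixMultiplication.Theorems.SoloBlindFlatBridge
import Summits.MatrixMultiplication.MatrixMultiplication.Theorems.SoloBlindTypeModel
import Summits.MatrixMultiplication.MatrixMultiplication.Theorems.SoloBlindFlatRankLemma

/-!
# The K♭ / E♭ checker: needs are met, and the core inside the block (configuration side)

In the setting of the type model (`SoloBlindTypeModel`: a linearly independent block `B`, outside
letters `x : Fin m ↪ ι` avoiding `B`, a target `τ`), with `F = soloBlindExactFam h B x τ` the exact
presence family and `t_e = soloBlindTyc hli x τ e` the type code of the basis index `e`: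

* at a present member the ambient residues vanish and the block residues are `0` or `1`; hence a
  block type is VISIBLE or all its residues over `F` vanish (its letter vector lies in `W⊥`);
* NEEDS ARE MET (`soloBlind_flatNeeds_met`): under zero-sum-freeness on `B ∪ X` (and `H`-goodness of
  `τ` in mode E) every need of the checker (`SoloBlindFlatCheck`) is killed by a visible block type;
* the core of `τ` on `B ∪ X` consists, inside the block, of the indices whose type has a residue `1`
  at some member (`soloBlind_mem_core_inl_iff`).
-/

namespace Summit.MatrixMultiplication.MatrixMultiplication.Theorems

open Finset Module

/-! ## The configuration: types of basis indices -/

section Model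

variable {G : Type*} [AddCommGroup G] [DecidableEq G] [Module (ZMod 3) G] {ι : Type*} [DecidableEq ι]

/-- The code of the type of the basis index `e` (block index or ambient index). -/
noncomputable def soloBlindTyc {h : ι → G} {B : Finset ι}
    (hli : LinearIndependent (ZMod 3) (fun i : B => h i)) {m : ℕ} (x : Fin m ↪ ι) (τ : G)
    (e : B ⊕ Basis.sumExtendIndex hli) : ℕ :=
  soloBlindTyCode (soloBlindTy hli (soloBlindVec h x τ) e)

omit [DecidableEq G] [DecidableEq ι] in
/-- Type codes are below `3^(m+1)`. -/
theorem soloBlindTyc_lt {h : ι → G} {B : Finset ι} (hli : LinearIndependent (ZMod 3) (fun i : B => h i))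
    {m : ℕ} (x : Fin m ↪ ι) (τ : G) (e : B ⊕ Basis.sumExtendIndex hli) :
    soloBlindTyc hli x τ e < 3 ^ (m + 1) :=
  soloBlindTyCode_lt _

omit [DecidableEq G] [DecidableEq ι] in
/-- Residue bridge for `soloBlindTyc`. -/
theorem soloBlind_resid_tyc {h : ι → G} {B : Finset ι} (hli : LinearIndependent (ZMod 3) (fun i : B => h i))
    {m : ℕ} (x : Fin m ↪ ι) (τ : G) (e : B ⊕ Basis.sumExtendIndex hli) (M : ℕ) :
    soloBlindResid m (soloBlindTyc hli x τ e) M =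
      (Basis.sumExtend hli).coord e (τ - ∑ a ∈ soloBlindDecSet m M, h (x a)) :=
  soloBlind_resid_ty hli x τ e M

omit [DecidableEq G] [DecidableEq ι] in
/-- Sum bridge for `soloBlindTyc`, letter part. -/
theorem soloBlind_tsum_tyc_false {h : ι → G} {B : Finset ι}
    (hli : LinearIndependent (ZMod 3) (fun i : B => h i)) {m : ℕ} (x : Fin m ↪ ι) (τ : G)
    (e : B ⊕ Basis.sumExtendIndex hli) (M : ℕ) :
    soloBlindTSum m (soloBlindTyc hli x τ e) M false =
      (Basis.sumExtend hli).coord e (∑ a ∈ soloBlindDecSet m M, h (x a)) := by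
  unfold soloBlindTyc
  rw [soloBlind_tsum_ty]
  simp

omit [DecidableEq G] [DecidableEq ι] in
/-- Sum bridge for `soloBlindTyc`, `τ`-augmented. -/
theorem soloBlind_tsum_tyc_true {h : ι → G} {B : Finset ι}
    (hli : LinearIndependent (ZMod 3) (fun i : B => h i)) {m : ℕ} (x : Fin m ↪ ι) (τ : G)
    (e : B ⊕ Basis.sumExtendIndex hli) (M : ℕ) :
    soloBlindTSum m (soloBlindTyc hli x τ e) M true =
      (Basis.sumExtend hli).coord e ((∑ a ∈ soloBlindDecSet m M, h (x a)) + τ) := by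
  unfold soloBlindTyc
  rw [soloBlind_tsum_ty]
  simp

omit [Module (ZMod 3) G] [DecidableEq ι] in
/-- Members of the exact family are below `2^m`. -/
theorem soloBlind_exactFam_lt {h : ι → G} {B : Finset ι} {m : ℕ} {x : Fin m ↪ ι} {τ : G} {M : ℕ}
    (hM : M ∈ soloBlindExactFam h B x τ) : M < 2 ^ m :=
  (soloBlind_mem_exactFam.mp hM).1

/-- PRESENT MEMBERS IN COORDINATES: at a member of the exact family the ambient residues vanish and
the block residues are `0` or `1`. -/
theorem soloBlind_resid_of_mem_exactFam {h : ι → G} {B : Finset ι}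
    (hli : LinearIndependent (ZMod 3) (fun i : B => h i)) {m : ℕ} (x : Fin m ↪ ι) (τ : G) {M : ℕ}
    (hM : M ∈ soloBlindExactFam h B x τ) :
    (∀ j, soloBlindResid m (soloBlindTyc hli x τ (Sum.inr j)) M = 0) ∧
      ∀ i : B, soloBlindResid m (soloBlindTyc hli x τ (Sum.inl i)) M = 0 ∨
        soloBlindResid m (soloBlindTyc hli x τ (Sum.inl i)) M = 1 := by
  obtain ⟨-, hne⟩ := soloBlind_mem_exactFam.mp hM
  obtain ⟨hamb, hblk⟩ := (soloBlind_repAll_nonempty_iff_coords h B hli _).mp hne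
  exact ⟨fun j => by rw [soloBlind_resid_tyc]; exact hamb j,
    fun i => by rw [soloBlind_resid_tyc]; exact hblk i⟩

/-- VISIBLE OR PERPENDICULAR: a block type is visible, or all its residues over `F` vanish. -/
theorem soloBlind_visible_or_resid_zero {h : ι → G} {B : Finset ι}
    (hli : LinearIndependent (ZMod 3) (fun i : B => h i)) {m : ℕ} (x : Fin m ↪ ι) (τ : G) (i : B) :
    soloBlindVisible (soloBlindMkFlatTabs m) m (soloBlindExactFam h B x τ)
        (soloBlindTyc hli x τ (Sum.inl i)) = true ∨
      ∀ M ∈ soloBlindExactFam h B x τ, soloBlindResid m (soloBlindTyc hli x τ (Sum.inl i)) M = 0 := by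
  by_cases hex : ∃ M ∈ soloBlindExactFam h B x τ, soloBlindResid m (soloBlindTyc hli x τ (Sum.inl i)) M = 1
  · obtain ⟨M, hM, h1⟩ := hex
    left
    refine soloBlind_visible_of_resid_one (fun M hM => soloBlind_exactFam_lt hM) (soloBlindTyc_lt hli x τ _)
      (fun M' hM' h2 => ?_) hM h1
    rcases (soloBlind_resid_of_mem_exactFam hli x τ hM').2 i with h0 | h1'
    · rw [h0] at h2; exact absurd h2 (by decide)
    · rw [h1'] at h2; exact absurd h2 (by decide)
  · right
    push Not at hex
    intro M hM
    rcases (soloBlind_resid_of_mem_exactFam hli x τ hM).2 i with h0 | h1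
    · exact h0
    · exact absurd h1 (hex M hM)

/-- NEEDS ARE MET: under zero-sum-freeness on `B ∪ X` (and `H`-goodness of `τ` in mode E) every need
of the checker, computed for the exact family and a present reference member `C₀`, is killed by a
visible block type of the configuration. -/
theorem soloBlind_flatNeeds_met {h : ι → G} {B : Finset ι}
    (hli : LinearIndependent (ZMod 3) (fun i : B => h i)) {m : ℕ} (x : Fin m ↪ ι)
    (hxB : ∀ a, x a ∉ B) (τ : G) (modeE : Bool)
    (zsf : ∀ T ⊆ B ∪ Finset.univ.map x, T.Nonempty → ∑ i ∈ T, h i ≠ 0)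
    (hgood : modeE = true → ∀ T ⊆ B ∪ Finset.univ.map x, ∑ i ∈ T, h i ≠ τ + τ)
    {C₀ : ℕ} (hC₀ : C₀ ∈ soloBlindExactFam h B x τ) {N : SoloBlindNeed}
    (hN : N ∈ soloBlindNeeds (soloBlindMkFlatTabs m) m (soloBlindExactFam h B x τ) C₀ modeE) :
    ∃ i : B, soloBlindVisible (soloBlindMkFlatTabs m) m (soloBlindExactFam h B x τ)
        (soloBlindTyc hli x τ (Sum.inl i)) = true ∧
      soloBlindKills (soloBlindMkFlatTabs m) m (soloBlindTyc hli x τ (Sum.inl i)) N = true := by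
  set F := soloBlindExactFam h B x τ with hFdef
  have hF : ∀ M ∈ F, M < 2 ^ m := fun M hM => soloBlind_exactFam_lt hM
  have hC₀2 : C₀ < 2 ^ m := hF C₀ hC₀
  have tlt : ∀ e, soloBlindTyc hli x τ e < 3 ^ (m + 1) := soloBlindTyc_lt hli x τ
  -- letter vectors in `W⊥`
  have hperp : ∀ e, (∀ M ∈ F, soloBlindResid m (soloBlindTyc hli x τ e) M = 0) →
      soloBlindTyc hli x τ e % 3 ^ m ∈ soloBlindWPerp (soloBlindMkFlatTabs m) m F C₀ :=
    fun e h0 => soloBlind_mem_wperp hF hC₀ h0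
  have hamb0 : ∀ j, ∀ M ∈ F, soloBlindResid m (soloBlindTyc hli x τ (Sum.inr j)) M = 0 :=
    fun j M hM => (soloBlind_resid_of_mem_exactFam hli x τ hM).1 j
  have hblk := soloBlind_visible_or_resid_zero hli x τ (B := B) (m := m)
  have three := soloBlind_three_of_module (G := G)
  unfold soloBlindNeeds at hN
  simp only [List.mem_append, List.mem_map] at hN
  rcases hN with (⟨U, hU, rfl⟩ | ⟨C, hC, rfl⟩) | hH
  · -- zero-sum need `U`
    obtain ⟨hU2, hU0⟩ := soloBlind_needZ_lt hU
    have hne : (soloBlindDecSet m U).Nonempty := soloBlindDecSet_nonempty hU0 hU2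
    have hwA : ∀ A : Finset B, (∑ a ∈ soloBlindDecSet m U, h (x a)) + ∑ i ∈ A, h (i : ι) ≠ 0 := by
      intro A
      obtain ⟨hsub, hsum⟩ := soloBlind_outside_block_sum h x hxB (soloBlindDecSet m U) A
      rw [← hsum]
      exact zsf _ hsub ((hne.map).mono Finset.subset_union_left)
    rcases (soloBlind_noZeroSum_iff_hit h B hli _).mp hwA with ⟨i, hi⟩ | ⟨j, hj⟩
    · have h1 : soloBlindTSum m (soloBlindTyc hli x τ (Sum.inl i)) U false = 1 := by
        rw [soloBlind_tsum_tyc_false]; exact hi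
      rcases hblk i with hvis | h0
      · refine ⟨i, hvis, ?_⟩
        simp only [soloBlindKills, beq_iff_eq]
        rw [soloBlind_flatTabs_ts (tlt _) hU2, h1]
        rfl
      · exfalso
        have key := soloBlind_needZ_perp hU (hperp _ h0)
        rw [h1] at key
        exact one_ne_zero key
    · exfalso
      have key := soloBlind_needZ_perp hU (hperp _ (hamb0 j))
      rw [soloBlind_tsum_tyc_false] at key
      exact hj key
  · -- exactness need `C`
    obtain ⟨hC2, hCF⟩ := soloBlind_needX_lt hC
    have hne : ¬ (soloBlindSeqRepAll h B (τ - ∑ a ∈ soloBlindDecSet m C, h (x a))).Nonempty :=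
      fun hne => hCF (soloBlind_mem_exactFam.mpr ⟨hC2, hne⟩)
    rw [soloBlind_repAll_nonempty_iff_coords h B hli] at hne
    by_cases hamb : ∀ j, (Basis.sumExtend hli).coord (Sum.inr j)
        (τ - ∑ a ∈ soloBlindDecSet m C, h (x a)) = 0
    · have hblk2 : ∃ i : B, soloBlindResid m (soloBlindTyc hli x τ (Sum.inl i)) C = 2 := by
        by_contra hno
        push Not at hno
        apply hne
        refine ⟨hamb, fun i => ?_⟩
        rw [← soloBlind_resid_tyc]
        by_contra hc
        push Not at hc
        exact hno i (soloBlind_zmod3_eq_two _ hc.1 hc.2)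
      obtain ⟨i, hi2⟩ := hblk2
      rcases hblk i with hvis | h0
      · refine ⟨i, hvis, ?_⟩
        simp only [soloBlindKills]
        rw [soloBlind_flatTabs_r2 (tlt _) hC2, hi2]
        decide
      · exfalso
        have key := soloBlind_needX_perp hC₀2 hC (hperp _ h0)
        rw [hi2, h0 C₀ hC₀] at key
        exact absurd key (by decide)
    · push Not at hamb
      obtain ⟨j, hj⟩ := hamb
      exfalso
      have key := soloBlind_needX_perp hC₀2 hC (hperp _ (hamb0 j))
      rw [hamb0 j C₀ hC₀, soloBlind_resid_tyc] at key
      exact hj key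
  · -- `H` need `U` (mode E)
    have hH' : modeE = true ∧ ∃ U ∈ soloBlindNeedH (soloBlindMkFlatTabs m) m C₀
        (soloBlindWPerp (soloBlindMkFlatTabs m) m F C₀), SoloBlindNeed.hh U = N := by
      revert hH
      cases modeE <;> simp
    obtain ⟨hmode, U, hU, rfl⟩ := hH'
    have hU2 := soloBlind_needH_lt hU
    have hwA : ∀ A : Finset B,
        (∑ a ∈ soloBlindDecSet m U, h (x a)) + τ + ∑ i ∈ A, h (i : ι) ≠ 0 := by
      intro A heq
      obtain ⟨hsub, hsum⟩ := soloBlind_outside_block_sum h x hxB (soloBlindDecSet m U) A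
      refine hgood hmode _ hsub ?_
      rw [hsum]
      have e1 : (∑ a ∈ soloBlindDecSet m U, h (x a)) + ∑ i ∈ A, h (i : ι) = -τ := by
        rw [eq_neg_iff_add_eq_zero, ← heq]
        abel
      rw [e1, neg_eq_iff_add_eq_zero, ← add_assoc, three]
    rcases (soloBlind_noZeroSum_iff_hit h B hli _).mp hwA with ⟨i, hi⟩ | ⟨j, hj⟩
    · have h1 : soloBlindTSum m (soloBlindTyc hli x τ (Sum.inl i)) U true = 1 := by
        rw [soloBlind_tsum_tyc_true]; exact hi
      rcases hblk i with hvis | h0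
      · refine ⟨i, hvis, ?_⟩
        simp only [soloBlindKills, beq_iff_eq]
        rw [soloBlind_flatTabs_tt (tlt _) hU2, h1]
        rfl
      · exfalso
        have key := soloBlind_needH_perp hC₀2 hU (hperp _ h0)
        rw [soloBlindTSum_false_eq m _ C₀, h0 C₀ hC₀, sub_zero, ← soloBlindTSum_true, h1] at key
        exact one_ne_zero key
    · exfalso
      have key := soloBlind_needH_perp hC₀2 hU (hperp _ (hamb0 j))
      rw [soloBlindTSum_false_eq m _ C₀, hamb0 j C₀ hC₀, sub_zero, ← soloBlindTSum_true,
        soloBlind_tsum_tyc_true] at key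
      exact hj key

omit [Module (ZMod 3) G] in
/-- GLUING A REPRESENTATION: a block representation `A` of `τ - ∑_{a ∈ M} h(x_a)` and the letters of `M`
form a representation of `τ` on `B ∪ X`, whose letter part is the decoded set of `M`. -/
theorem soloBlind_unionRep_mem {h : ι → G} {B : Finset ι} {m : ℕ} (x : Fin m ↪ ι) (hxB : ∀ a, x a ∉ B)
    {τ : G} {M : ℕ} {A : Finset ι}
    (hA : A ∈ soloBlindSeqRepAll h B (τ - ∑ a ∈ soloBlindDecSet m M, h (x a))) :
    (soloBlindDecSet m M).map x ∪ A ∈ soloBlindSeqRepAll h (B ∪ Finset.univ.map x) τ ∧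
      soloBlindLetterPart x ((soloBlindDecSet m M).map x ∪ A) = soloBlindDecSet m M := by
  obtain ⟨hAB, hAsum⟩ := soloBlind_mem_seqRepAll.mp hA
  constructor
  · rw [soloBlind_mem_seqRepAll]
    refine ⟨Finset.union_subset
      ((Finset.map_subset_map.mpr (Finset.subset_univ _)).trans Finset.subset_union_right)
      (hAB.trans Finset.subset_union_left), ?_⟩
    have hdisj : Disjoint ((soloBlindDecSet m M).map x) A := by
      rw [Finset.disjoint_left]
      intro y hy hyA
      obtain ⟨a, -, rfl⟩ := Finset.mem_map.mp hy
      exact hxB a (hAB hyA)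
    rw [Finset.sum_union hdisj, Finset.sum_map, hAsum]
    abel
  · unfold soloBlindLetterPart
    ext k
    rw [Finset.mem_filter, Finset.mem_union, Finset.mem_map' x]
    constructor
    · rintro ⟨-, hk | hk⟩
      · exact hk
      · exact absurd (hAB hk) (hxB k)
    · exact fun hk => ⟨Finset.mem_univ _, Or.inl hk⟩

/-- THE CORE INSIDE THE BLOCK: a block index lies in the core of `τ` on `B ∪ X` iff its type has a
residue `1` at some member of the exact family. -/
theorem soloBlind_mem_core_inl_iff {h : ι → G} {B : Finset ι}
    (hli : LinearIndependent (ZMod 3) (fun i : B => h i)) {m : ℕ} (x : Fin m ↪ ι)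
    (hxB : ∀ a, x a ∉ B) (τ : G) (i : B) :
    (i : ι) ∈ soloBlindCore h (B ∪ Finset.univ.map x) τ ↔
      ∃ M ∈ soloBlindExactFam h B x τ, soloBlindResid m (soloBlindTyc hli x τ (Sum.inl i)) M = 1 := by
  classical
  rw [soloBlind_mem_core]
  constructor
  · rintro ⟨T, hT, hiT⟩
    obtain ⟨hTS, hTsum⟩ := soloBlind_mem_seqRepAll.mp hT
    have hCsub : T.filter (fun y => y ∉ B) ⊆ Finset.univ.map x := by
      intro y hy
      rw [Finset.mem_filter] at hy
      rcases Finset.mem_union.mp (hTS hy.1) with hyB | hyX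
      · exact absurd hyB hy.2
      · exact hyX
    obtain ⟨M, hM2, hMC⟩ := soloBlind_exists_mask x hCsub
    have hA : T.filter (fun y => y ∈ B) ∈
        soloBlindSeqRepAll h B (τ - ∑ a ∈ soloBlindDecSet m M, h (x a)) := by
      rw [soloBlind_mem_seqRepAll]
      refine ⟨fun y hy => (Finset.mem_filter.mp hy).2, ?_⟩
      rw [eq_sub_iff_add_eq, ← Finset.sum_map (soloBlindDecSet m M) x h, hMC,
        Finset.sum_filter_add_sum_filter_not, hTsum]
    refine ⟨M, soloBlind_mem_exactFam.mpr ⟨hM2, ⟨_, hA⟩⟩, ?_⟩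
    rw [soloBlind_resid_tyc]
    exact (soloBlind_mem_repAll_iff_coord_eq_one h B hli hA i).mp
      (Finset.mem_filter.mpr ⟨hiT, i.2⟩)
  · rintro ⟨M, hM, h1⟩
    obtain ⟨-, ⟨A, hA⟩⟩ := soloBlind_mem_exactFam.mp hM
    rw [soloBlind_resid_tyc] at h1
    have hiA : (i : ι) ∈ A := (soloBlind_mem_repAll_iff_coord_eq_one h B hli hA i).mpr h1
    exact ⟨(soloBlindDecSet m M).map x ∪ A, (soloBlind_unionRep_mem x hxB hA).1,
      Finset.mem_union_right _ hiA⟩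

omit [Module (ZMod 3) G] in
/-- USED LETTERS LIE IN THE CORE: a letter contained in some member of the exact family is in the core. -/
theorem soloBlind_letter_mem_core {h : ι → G} {B : Finset ι} {m : ℕ} (x : Fin m ↪ ι)
    (hxB : ∀ a, x a ∉ B) (τ : G) {M : ℕ} (hM : M ∈ soloBlindExactFam h B x τ) {a : Fin m}
    (ha : M.testBit a = true) : x a ∈ soloBlindCore h (B ∪ Finset.univ.map x) τ := by
  obtain ⟨-, ⟨A, hA⟩⟩ := soloBlind_mem_exactFam.mp hM
  rw [soloBlind_mem_core]
  refine ⟨_, (soloBlind_unionRep_mem x hxB hA).1, Finset.mem_union_left _ ?_⟩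
  rw [Finset.mem_map' x]
  exact (soloBlind_mem_decSet a).mpr ha

end Model

end Summit.MatrixMultiplication.MatrixMultiplication.Theorems
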